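import Mathlib.AlgebraicGeometry.Geometrically.Connected
import Literature.AlgebraicGeometry.Motives.FamiliesVHS
import Literature.AlgebraicGeometry.HodgeTheory.HodgeConjecture
import HarnessLib

/-!
# The Hodge conjecture for fourfolds fibred over a surface by surfaces of geometric genus zero
# (Arapura 2022, Cor. 1.5)

Topic `Literature/AlgebraicGeometry/HodgeTheory`. One NAMED FACT (D-0014, `def … : Prop`, users
take `(h : Arapura2022_hodgeConjecture_fourfold_fibredBySurfaces_pg_zero)`), vendored for route
HodgeConjecture/NoetherLefschetzOneUp: it grounds the support item
`Summit.HodgeConjecture.HodgeConjecture.Theses.NoetherLefschetzOneUp.LevelZeroNets` (base `Y = ℙ²`;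
the item's conclusion "rational `(2,2)`-classes lie in algebraic ⊔ vertical classes" is WEAKER than
the printed "the Hodge conjecture holds for `X`", and the item does not spell out the connectedness
of ALL fibres — see "Rendering").

Source read (this session, held `paper:arxiv-2103.05038` = Pacific J. Math. 319 (2022) 233–258),
verbatim:

* §1 (standing hypotheses, arXiv p. 3): "let us suppose that `f : X → Y` is a surjective morphism
  with connected fibres between smooth projective varieties. We suppose also that `dim Y < dim X`.
  […] choose a nonempty Zariski open subset `U ⊂ Y`, such that `f` is smooth over `U`, and let
  `V = f⁻¹U`."
* Cor. 1.4: "Suppose that `dim X = 4`, and `dim Y = m`. If the cycle map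
  `□^{2,m} : Gr^m_L CH²(V) → Hodge(H^m(U, R^{4-m} f_*ℚ)(2))` is surjective, then the Hodge
  conjecture holds for `X`. In particular, this is the case if `Hodge(H^m(U, R^{4-m} f_*ℚ)(2)) = 0`."
  — followed by "The corollary also implies a result of Conte and Murre that the Hodge conjecture
  holds for uniruled fourfolds. Similarly, the conjecture holds for fourfolds fibred by surfaces
  with trivial geometric genus:"
* **Cor. 1.5**: "Suppose that `dim X = 4`, and `dim Y = 2`, and the general fibre of `f : X → Y`
  is a surface with `p_g = 0`. Then the Hodge conjecture holds for `X`." (Proof: relative Hilbert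
  scheme, divisors `Z₁, …, Z_N ⊂ X_y` spanning `H²(X_y, ℚ)` by Lefschetz `(1,1)` since
  `p_g(X_y) = 0`, spread to relative divisors `𝒵_i` after a finite base change,
  `H²(U, R²f_*ℚ) ≅ ⊕_i H²(U, ℚ) ∪ [𝒵_i]`, and Lefschetz `(1,1)` on the base.)
* Remark 1.6 (not vendored: needs the transcendental sub-variation `T ⊆ R²f_*ℚ|_U`, no carrier in
  the tree): "the Hodge conjecture holds for `X`, if `Hodge(H²(U, T)(2)) = 0`."

## Rendering

* "smooth projective varieties", `dim X = 4`, `dim Y = 2`: the tree's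
  `Motives.IsSmoothProjective 4 X`, `Motives.IsSmoothProjective 2 Y` (smooth of the stated relative
  dimension over `Spec ℂ`, projective, geometrically irreducible).
* "surjective morphism with connected fibres": `f : X ⟶ Y` over `Spec ℂ` with
  `Function.Surjective f.left.base` and Mathlib's `GeometricallyConnected f.left` (every
  scheme-theoretic fibre `X ×_Y Spec K` connected — for a proper morphism of complex varieties the
  usual meaning of "connected fibres", cf. `Morphisms/SteinFactorization.lean`).
* "the general fibre of `f` is a surface with `p_g = 0`": there is a Zariski-closed `T ⊊ Y` such
  that the fibre `fiberOver f s` over every `ℂ`-point `s ∉ T` is a smooth projective surface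
  (`IsSmoothProjective 2`) admitting a Hodge model `A` with `h^{2,0} = dim_ℂ H^{2,0}(X_s) = 0`
  (`Module.finrank ℂ (A.hodgePQ 2 2 0) = 0`; all Hodge models give the same `H^{p,q}`,
  `hodgePQ_independent_of_hodgeModel`). This is exactly the fibre hypothesis of the route items
  `LevelZeroNets` / `K3TypeNets` / `GeneralTypeNets` (with `= 0`, `= 1`, `≥ 2`).
* "the Hodge conjecture holds for `X`": the cycle conjunct of `HodgeConjectureFor 4 X` — every
  rational class of Hodge type `(p,p)` in `H²ᵖ(X(ℂ); ℂ)` lies in `algebraicClasses X p`, for every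
  `p` (the anti-vacuity conjunct `Nonempty (HodgeModel 4 X)` of `HodgeConjectureFor` is a separate
  theorem, `nonempty_hodgeModel`, and is not part of what Cor. 1.5 asserts).

To instantiate the fact on the route item (`Y := Motives.projectiveSpace 2 ℂ`) a prover needs
`Motives.isSmoothProjective_projectiveSpace_holds ℂ 2` and the connectedness of all fibres of a
surjective `f : X → ℙ²` whose general fibre is (geometrically) irreducible — Stein factorisation
towards a normal base (`Morphisms.geometricallyConnected_towards_normal`, Stacks 0AY8); the item is
therefore NOT a mere specialisation of the fact (noted on stmt-HodgeConjecture-11602).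

## References

* [Arapura2022] D. Arapura, *Hodge cycles and the Leray filtration*, Pacific J. Math. 319 (2022)
  233–258 = arXiv:2103.05038, §1, Thm. 1.2, Cor. 1.4, **Cor. 1.5**, Remark 1.6.
* [ConteMurre1978] A. Conte, J. P. Murre, *The Hodge conjecture for fourfolds admitting a covering
  by rational curves*, Math. Ann. 238 (1978) 79–88 (the uniruled case recovered by Cor. 1.4).
* [Deligne2000] P. Deligne, *The Hodge conjecture*, Clay problem description, §1.
-/

noncomputable section

open CategoryTheory AlgebraicGeometry

namespace Literature.AlgebraicGeometry.HodgeTheory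

open Literature.AlgebraicGeometry.Motives

/-- **Arapura 2022, Cor. 1.5: the Hodge conjecture holds for a smooth projective fourfold fibred
over a smooth projective surface, with connected fibres, by surfaces of geometric genus zero.**
"Suppose that `dim X = 4`, and `dim Y = 2`, and the general fibre of `f : X → Y` is a surface
with `p_g = 0`. Then the Hodge conjecture holds for `X`" — under the standing hypotheses of §1:
`f` a surjective morphism with connected fibres between smooth projective complex varieties.
Rendering (module docstring): `GeometricallyConnected f.left` for "connected fibres"; the general
fibre condition through a proper Zariski-closed `T ⊊ Y` off which the `ℂ`-fibres `fiberOver f s`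
are smooth projective surfaces with a Hodge model having `dim H^{2,0} = 0`; conclusion = the cycle
conjunct of `HodgeConjectureFor 4 X` (all `p`). Grounds
`Summit.HodgeConjecture.HodgeConjecture.Theses.NoetherLefschetzOneUp.LevelZeroNets` (base `ℙ²`,
weaker conclusion; the item leaves the connectedness of the special fibres to Stein
factorisation). [cite: Arapura2022, Cor. 1.5 (with §1 and Cor. 1.4)] -/
def Arapura2022_hodgeConjecture_fourfold_fibredBySurfaces_pg_zero : Prop :=
  ∀ ⦃X Y : SchemeOver ℂ⦄ (f : X ⟶ Y), IsSmoothProjective 4 X → IsSmoothProjective 2 Y →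
    Function.Surjective f.left.base → GeometricallyConnected f.left →
    (∃ T : Set Y.left, IsClosed T ∧ T ≠ Set.univ ∧
      ∀ s : AlgPoints Y ℂ, s.pt ∉ T →
        IsSmoothProjective 2 (fiberOver f s) ∧
          ∃ A : HodgeModel 2 (fiberOver f s), Module.finrank ℂ ↥(A.hodgePQ 2 2 0) = 0) →
    ∀ (p : ℕ) (c : complexBetti X (2 * p)),
      IsRationalClass c → IsOfHodgeType 4 X (2 * p) p p c → c ∈ algebraicClasses X p

/-! ### Consequences -/

namespace Arapura2022_hodgeConjecture_fourfold_fibredBySurfaces_pg_zero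

/-- With a Hodge model in hand (the tree's `nonempty_hodgeModel`, or any other source), Cor. 1.5
gives the full `HodgeConjectureFor 4 X`. [cite: Arapura2022, Cor. 1.5] -/
theorem hodgeConjectureFor (h : Arapura2022_hodgeConjecture_fourfold_fibredBySurfaces_pg_zero)
    {X Y : SchemeOver ℂ} (f : X ⟶ Y) (hX : IsSmoothProjective 4 X) (hY : IsSmoothProjective 2 Y)
    (hf : Function.Surjective f.left.base) (hconn : GeometricallyConnected f.left)
    (hgen : ∃ T : Set Y.left, IsClosed T ∧ T ≠ Set.univ ∧
      ∀ s : AlgPoints Y ℂ, s.pt ∉ T →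
        IsSmoothProjective 2 (fiberOver f s) ∧
          ∃ A : HodgeModel 2 (fiberOver f s), Module.finrank ℂ ↥(A.hodgePQ 2 2 0) = 0)
    (hA : Nonempty (HodgeModel 4 X)) : HodgeConjectureFor 4 X :=
  ⟨hA, h f hX hY hf hconn hgen⟩

/-- The degree-four instance used by route NoetherLefschetzOneUp (`p = 2`): every rational
`(2,2)`-class of such a fourfold is algebraic — in particular it lies in
`algebraicClasses X 2 ⊔ V` for any submodule `V` (the route's "algebraic ⊔ vertical" form).
[cite: Arapura2022, Cor. 1.5] -/
theorem span_le_sup (h : Arapura2022_hodgeConjecture_fourfold_fibredBySurfaces_pg_zero)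
    {X Y : SchemeOver ℂ} (f : X ⟶ Y) (hX : IsSmoothProjective 4 X) (hY : IsSmoothProjective 2 Y)
    (hf : Function.Surjective f.left.base) (hconn : GeometricallyConnected f.left)
    (hgen : ∃ T : Set Y.left, IsClosed T ∧ T ≠ Set.univ ∧
      ∀ s : AlgPoints Y ℂ, s.pt ∉ T →
        IsSmoothProjective 2 (fiberOver f s) ∧
          ∃ A : HodgeModel 2 (fiberOver f s), Module.finrank ℂ ↥(A.hodgePQ 2 2 0) = 0)
    (V : Submodule ℂ (complexBetti X (2 * 2))) :
    Submodule.span ℂ {c : complexBetti X (2 * 2) | IsRationalClass c ∧ IsOfHodgeType 4 X (2 * 2) 2 2 c}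
      ≤ algebraicClasses X 2 ⊔ V := by
  refine le_trans (Submodule.span_le.mpr ?_) le_sup_left
  rintro c ⟨hc, hpp⟩
  exact h f hX hY hf hconn hgen 2 c hc hpp

end Arapura2022_hodgeConjecture_fourfold_fibredBySurfaces_pg_zero

end Literature.AlgebraicGeometry.HodgeTheory

end
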